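import Summits.BirchSwinnertonDyer.Rank1Residual.X11b.BDPRouteRankOneBookkeeping
import HarnessLib

/-!
# Class X11b, route p2: the local index at `p` WITHOUT (iv) — the exponent `e(Q) = v(Ψ Q)`
# (`= ord_p log_ω Q + ord_p c_p − 1` at a multiplicative `p`, torsion or not), `e(mQ + t) = ord_p m + e(Q)`,
# and `p^k E(ℚ_p) + im E(K) = p^k E(ℚ_p) + ℤ Q_ι` when `E(K)` has no `p`-torsion
# (cell `b2b-bsdres`, sub-cell `multr1-p2`, gen 17)

HONEST FRAMING (verbatim, cell `b2b-bsdres`): the goal of the cell is to DELETE the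
COMBINATION-SHAPED residual classes for ALL analytic-rank `≤ 1` curves over `ℚ` — "full BSD
formula for every rank `≤ 1` curve in class `C`" assembled STRICTLY from published theorems — so
that the rank-`≤ 1` remainder becomes exactly the CONSTRUCTION-SHAPED classes, which are TYPED
(missing-input Props), NOT attempted; this is not "finishing BSD". Research route `p2` for class
X11b; no claim beyond the stated class; nothing booked; X11b stays CONSTRUCTION-SHAPED. Theorems
only; no definition; no named fact; no `sorry`. Continues `BDPRouteLocalIndex` (gen 15),
`BDPRouteRankOneBookkeeping` (gen 16); companion of `ZpLineIndexTorsion` (gen 17).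

## Content

Gen 15/16 computed the local index `[E(ℚ_p) : p^k E(ℚ_p) + ℤ Q] = p^{min(k, e(Q))}` and the exponent
bookkeeping `e(Q) + ord_p c(P) ≤ e(P)` under (iv) `E(ℚ_p)[p] = 0`. Without (iv) the exponent is still
the valuation of the `ℤ_p`-coordinate `Ψ(Q) = L([E:E⁽²⁾]•Q)/p²` and obeys the same formula; only the
index formulas change (`ZpLineIndexTorsion`). Here, with NO hypothesis on `E(ℚ_p)[p]`:

* **`exists_addEquiv_valuation_psi_eq`** — for a `ℤ_p`-minimal `X/ℚ_p` there is
  `φ : E⁽²⁾(ℚ_p) ≃+ ℤ_p` with `v(Ψ_φ Q) = (ord_p log_W z(m₁Q) − ord_p m₁) + ord_p c_p + ord_p #Ẽ_ns(𝔽_p) − 1`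
  for EVERY `Q` of infinite order (gen 15's computation, (iv)-free);
  `exists_addEquiv_valuation_psi_padicPointOf_of_mult` — in the route's currency at a multiplicative
  `p`: `v(Ψ_φ P_ι) = padicLogOrd W p ι P + ord_p c_p − 1`.
* `valuation_intCast_padicInt`, **`valuation_psi_zsmul_add`** — `v(Ψ(m • x + t)) = ord_p m + v(Ψ x)`
  (`t` torsion, `m ≠ 0`, `x` of infinite order): `Ψ` kills torsion and is additive.
* `mem_range_nsmul_pow_of_coprime`, **`range_nsmul_sup_range_eq_of_source`** —
  `p^k G + im f = p^k G + ℤ f(Q)` for `f : A → G` when `A = ℤQ + (torsion)` has NO `p`-torsion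
  (the torsion of `E(K)`, of order prime to `p`, maps into `p^k E(ℚ_p)`); gen 16 assumed this of `G`.

Nothing booked; labels unchanged.

References: [Castella2018] proof of Thm. 2.3, (calcul) (arXiv:1704.06608 p. 6);
[JetchevSkinnerWan2017] (7.1.5) (arXiv:1512.06894 p. 16); [SilvermanAEC2009] IV.6.4, VII.6.3.
-/

noncomputable section

open scoped Classical

namespace Summit.BirchSwinnertonDyer.Rank1Residual.X11b.LocalIndex

variable {p : ℕ} [Fact p.Prime]

/-! ## §1 Pure algebra: `Ψ` of multiples, `p^k`-divisibility of prime-to-`p` torsion -/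

section Algebra

variable {G : Type*} [AddCommGroup G]

omit [Fact p.Prime] in
/-- An element of finite order prime to `p` is a `p^k`-th multiple (`g = p^k • (a • g)` with
`a p^k ≡ 1` modulo its order). [folklore] -/
theorem mem_range_nsmul_pow_of_coprime (k : ℕ) {g : G} (hg : IsOfFinAddOrder g)
    (hcop : (addOrderOf g).Coprime p) : g ∈ (nsmulAddMonoidHom (p ^ k) : G →+ G).range := by
  have hcop' : (p ^ k).Coprime (addOrderOf g) := Nat.Coprime.pow_left k hcop.symm
  rcases Nat.eq_or_lt_of_le (Nat.one_le_iff_ne_zero.mpr hg.addOrderOf_pos.ne') with h1 | h1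
  · have : g = 0 := by rw [← AddMonoid.addOrderOf_eq_one_iff, ← h1]
    exact ⟨0, by rw [this, map_zero]⟩
  · obtain ⟨a, -, ha⟩ := Nat.exists_mul_mod_eq_one_of_coprime hcop' h1
    refine ⟨a • g, ?_⟩
    rw [nsmulAddMonoidHom_apply, ← mul_nsmul', ← Nat.div_add_mod (p ^ k * a) (addOrderOf g), ha,
      add_nsmul, one_nsmul, mul_comm, mul_nsmul', addOrderOf_nsmul_eq_zero, nsmul_zero, zero_add]

/-- **`p^k G + im f = p^k G + ℤ f(Q)`** for `f : A →+ G` when `A = ℤQ + (torsion)` (`a − c(a)•Q`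
torsion for a coordinate `c`) and `A` has NO `p`-torsion: the torsion of `A` has order prime to `p`,
so its image lies in `p^k G`. (Gen 16's `range_nsmul_sup_range_eq` assumed instead that `G` has no
`p`-torsion.) [folklore] -/
theorem range_nsmul_sup_range_eq_of_source {A : Type*} [AddCommGroup A] (f : A →+ G)
    (c : A →+ ℤ) (Q : A) (hA : ∀ a : A, IsOfFinAddOrder (a - c a • Q)) (k : ℕ)
    (hivA : ∀ a : A, p • a = 0 → a = 0) :
    (nsmulAddMonoidHom (p ^ k) : G →+ G).range ⊔ f.range =
      (nsmulAddMonoidHom (p ^ k) : G →+ G).range ⊔ AddSubgroup.zmultiples (f Q) := by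
  apply le_antisymm
  · refine sup_le le_sup_left ?_
    rintro _ ⟨a, rfl⟩
    have ha : f a = c a • f Q + f (a - c a • Q) := by
      rw [map_sub, map_zsmul]; abel
    rw [ha]
    refine AddSubgroup.add_mem _ (AddSubgroup.mem_sup_right ?_) (AddSubgroup.mem_sup_left ?_)
    · exact AddSubgroup.zsmul_mem _ (AddSubgroup.mem_zmultiples _) _
    · refine mem_range_nsmul_pow_of_coprime k (f.isOfFinAddOrder (hA a)) ?_
      exact (coprime_addOrderOf hivA (hA a)).coprime_dvd_left (addOrderOf_map_dvd f _)
  · refine sup_le le_sup_left ?_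
    rw [AddSubgroup.zmultiples_le]
    exact AddSubgroup.mem_sup_right ⟨Q, rfl⟩

/-- The valuation of an integer in `ℤ_p` is its `p`-adic valuation. [folklore] -/
theorem valuation_intCast_padicInt (m : ℤ) : ((m : ℤ_[p])).valuation = padicValNat p m.natAbs := by
  have h : (((m : ℤ_[p]) : ℚ_[p])).valuation = ((m : ℤ_[p]).valuation : ℤ) :=
    PadicInt.valuation_coe _
  rw [PadicInt.coe_intCast, Padic.valuation_intCast] at h
  exact_mod_cast h.symm

variable (E : AddSubgroup G) [hE : E.FiniteIndex] (φ : E ≃+ ℤ_[p])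

/-- **`v(Ψ(m • x + t)) = ord_p m + v(Ψ x)`** for `t` of finite order, `m ≠ 0` and `x` of infinite
order: `Ψ` kills torsion (`psi_eq_zero_iff`) and `Ψ(m • x) = m · Ψ(x)` in `ℤ_p`. Read with `x = Q_ι`,
`m • x + t = P_ι`, `m = c(P)`: the exponent at the Heegner point exceeds the one at the generator by
EXACTLY `ord_p [E(K) : ℤP]`. [cite: Castella2018, proof of Thm. 2.3, (3.2.1)–(calcul) (arXiv:1704.06608 p. 6)] -/
theorem valuation_psi_zsmul_add {x t : G} (hx : ¬ IsOfFinAddOrder x) (ht : IsOfFinAddOrder t)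
    {m : ℤ} (hm : m ≠ 0) :
    (psi E φ (m • x + t)).valuation = padicValNat p m.natAbs + (psi E φ x).valuation := by
  have hpsit : psi E φ t = 0 := (psi_eq_zero_iff E φ t).mpr ht
  have hpsix : psi E φ x ≠ 0 := fun h ↦ hx ((psi_eq_zero_iff E φ x).mp h)
  have hmZ : ((m : ℤ_[p])) ≠ 0 := Int.cast_ne_zero.mpr hm
  rw [map_add, hpsit, add_zero, map_zsmul, zsmul_eq_mul, PadicInt.valuation_mul hmZ hpsix,
    valuation_intCast_padicInt]

end Algebra

/-! ## §2 The exponent `v(Ψ Q)` on `E(ℚ_p)`, (iv)-free -/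

section Curve

variable (X : WeierstrassCurve ℚ_[p]) [X.IsIntegral ℤ_[p]] [X.IsElliptic] [X.IsMinimal ℤ_[p]]

/-- **The exponent, (iv)-free.** For a `ℤ_p`-integral elliptic `X/ℚ_p` there is `φ : E⁽²⁾(ℚ_p) ≃+ ℤ_p`
(`P ↦ L(P)/p²`) such that for EVERY `Q ∈ E(ℚ_p)` of infinite order
`v(Ψ_φ Q) = (ord_p log_W z(m₁Q) − ord_p m₁) + ord_p c_p + ord_p #Ẽ_ns(𝔽_p) − 1`, `m₁ = [E(ℚ_p):E₁(ℚ_p)]`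
— gen 15's computation (`Ψ Q = L(N₂ Q)/p²`, `N₂ = p m₁`, `‖log‖ = ‖L‖` on `E⁽²⁾`), which never used
(iv). [cite: Castella2018, proof of Thm. 2.3, (calcul) (arXiv:1704.06608 p. 6)]
[cite: JetchevSkinnerWan2017, (7.1.5) (arXiv:1512.06894 p. 16)] [cite: SilvermanAEC2009, IV.6.4, VII.6.3] -/
theorem exists_addEquiv_valuation_psi_eq [(X.formalFiltration 2).FiniteIndex] :
    ∃ φ : X.formalFiltration 2 ≃+ ℤ_[p], ∀ (Q : X.toAffine.Point), ¬ IsOfFinAddOrder Q →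
      ((psi (X.formalFiltration 2) φ Q).valuation : ℤ) =
        ((X.padicLogPoint ((X.formalFiltration 1).index • Q)).valuation -
            (padicValNat p (X.formalFiltration 1).index : ℤ)) +
          padicValNat p (X.localTamagawaNumber ℤ_[p]) +
            padicValNat p (Nat.card (X.reduction ℤ_[p]).toAffine.Point) - 1 := by
  haveI := X.finiteIndex_formalFiltration 1
  obtain ⟨φ, hφ⟩ := exists_formalFiltration_two_addEquiv X
  refine ⟨φ, fun Q hQ ↦ ?_⟩
  -- `Ψ Q = L(N₂ Q)/p²`, `N₂ Q ∈ E⁽²⁾`, `N₂ Q ≠ 0`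
  have hmem : (X.formalFiltration 2).index • Q ∈ X.formalFiltration 2 :=
    (X.formalFiltration 2).nsmul_index_mem Q
  have hN₂ne : (X.formalFiltration 2).index • Q ≠ 0 := fun h ↦ hQ (isOfFinAddOrder_iff_nsmul_eq_zero.mpr
    ⟨_, Nat.pos_of_ne_zero (AddSubgroup.FiniteIndex.index_ne_zero (H := X.formalFiltration 2)), h⟩)
  have hL0 : X.padicLimitLog ((X.formalFiltration 2).index • Q) ≠ 0 :=
    fun h ↦ hN₂ne (X.eq_zero_of_padicLimitLog_eq_zero le_rfl hmem h)
  have hp0 : (p : ℚ_[p]) ≠ 0 := Nat.cast_ne_zero.mpr (Fact.out : p.Prime).ne_zero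
  have hpsi : ((psi (X.formalFiltration 2) φ Q : ℤ_[p]) : ℚ_[p]) =
      X.padicLimitLog ((X.formalFiltration 2).index • Q) / (p : ℚ_[p]) ^ 2 := by
    rw [psi_apply]; exact hφ ⟨_, hmem⟩
  -- valuations
  have hv1 : ((psi (X.formalFiltration 2) φ Q).valuation : ℤ) =
      (X.padicLimitLog ((X.formalFiltration 2).index • Q)).valuation - 2 := by
    rw [← PadicInt.valuation_coe, hpsi, div_eq_mul_inv,
      Padic.valuation_mul hL0 (inv_ne_zero (pow_ne_zero _ hp0)), Padic.valuation_inv,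
      Padic.valuation_pow, Padic.valuation_p]
    ring
  have hv2 : (X.padicLimitLog ((X.formalFiltration 2).index • Q)).valuation =
      (X.padicLogPoint ((X.formalFiltration 2).index • Q)).valuation :=
    (valuation_padicLogPoint_eq X hmem).symm
  -- `N₂ = p m₁` and `log(N₂ Q) = p · log(m₁ Q)`
  have hN : (X.formalFiltration 2).index = p * (X.formalFiltration 1).index := index_formalFiltration_two X
  have hm₁mem : X.IsInReductionKernel ((X.formalFiltration 1).index • Q) :=
    ((X.formalFiltration 1).nsmul_index_mem Q).1
  have hlog : X.padicLogPoint ((X.formalFiltration 2).index • Q) =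
      (p : ℚ_[p]) * X.padicLogPoint ((X.formalFiltration 1).index • Q) := by
    rw [hN, mul_nsmul']
    exact (padicLogPoint_nsmul X ((X.formalFiltration 1).index • Q) hm₁mem p).2
  have hlog0 : X.padicLogPoint ((X.formalFiltration 2).index • Q) ≠ 0 := by
    intro h
    have h' := norm_padicLogPoint_eq_norm_padicLimitLog X hmem
    rw [h, norm_zero, eq_comm, norm_eq_zero] at h'
    exact hL0 h'
  have hlogm0 : X.padicLogPoint ((X.formalFiltration 1).index • Q) ≠ 0 := by
    intro h; rw [h, mul_zero] at hlog; exact hlog0 hlog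
  have hv3 : (X.padicLogPoint ((X.formalFiltration 2).index • Q)).valuation =
      1 + (X.padicLogPoint ((X.formalFiltration 1).index • Q)).valuation := by
    rw [hlog, Padic.valuation_mul hp0 hlogm0, Padic.valuation_p]
  rw [hv1, hv2, hv3, padicValNat_index_formalFiltration_one X]
  push_cast
  ring

end Curve

/-! ## §3 In the route's currency, at a multiplicative `p` -/

section Global

open WeierstrassCurve Literature.NumberTheory.EllipticCurves.Rank1Residual

variable (W : WeierstrassCurve ℚ) [W.IsElliptic] [W.IsGloballyMinimal] (p : ℕ) [Fact p.Prime]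
  {K : Type} [Field K] [NumberField K]

/-- The exponent in the route's currency `padicLogOrd`, (iv)-free: there is `φ : E⁽²⁾(ℚ_p) ≃+ ℤ_p`
with `v(Ψ_φ P_ι) = padicLogOrd W p ι P + ord_p c_p(E) + ord_p #Ẽ_ns(𝔽_p) − 1` for every embedding
`ι : K → ℚ_p` and `P ∈ E(K)` with `P_ι` of infinite order.
[cite: Castella2018, proof of Thm. 2.3, (calcul) (arXiv:1704.06608 p. 6)]
[cite: JetchevSkinnerWan2017, (7.1.5) (arXiv:1512.06894 p. 16)] -/
theorem exists_addEquiv_valuation_psi_padicPointOf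
    [((W.baseChange ℚ_[p]).formalFiltration 2).FiniteIndex] :
    ∃ φ : (W.baseChange ℚ_[p]).formalFiltration 2 ≃+ ℤ_[p],
      ∀ (ι : K →+* ℚ_[p]) (P : (W.baseChange K).toAffine.Point),
        ¬ IsOfFinAddOrder (padicPointOf W p ι P) →
        ((psi ((W.baseChange ℚ_[p]).formalFiltration 2) φ (padicPointOf W p ι P)).valuation : ℤ) =
          padicLogOrd W p ι P +
            padicValNat p ((W.baseChange ℚ_[p]).localTamagawaNumber ℤ_[p]) +
              padicValNat p (reductionPointCount W p) - 1 := by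
  obtain ⟨φ, hφ⟩ := exists_addEquiv_valuation_psi_eq (W.baseChange ℚ_[p])
  refine ⟨φ, fun ι P hP ↦ ?_⟩
  rw [hφ _ hP, LocalTorsion.natCard_point_reduction_baseChange_padic W p]
  rfl

/-- **The exponent in the route's currency, (iv)-free, at a MULTIPLICATIVE `p`.** For the globally
minimal `W/ℚ` with `Mult W p` there is `φ : E⁽²⁾(ℚ_p) ≃+ ℤ_p` such that for EVERY embedding
`ι : K → ℚ_p` and `P ∈ E(K)` with `P_ι` of infinite order,
`v(Ψ_φ P_ι) = padicLogOrd W p ι P + ord_p c_p(E) − 1` (`#Ẽ_ns(𝔽_p) = p ∓ 1` is a `p`-unit) — the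
exponent of Castella's (calcul) / JSW (7.1.5) at the point, whether or not `E(ℚ_p)[p] = 0`.
[cite: Castella2018, proof of Thm. 2.3, (calcul) (arXiv:1704.06608 p. 6)]
[cite: JetchevSkinnerWan2017, (7.1.5) (arXiv:1512.06894 p. 16)] -/
theorem exists_addEquiv_valuation_psi_padicPointOf_of_mult (hmult : Mult W p)
    [((W.baseChange ℚ_[p]).formalFiltration 2).FiniteIndex] :
    ∃ φ : (W.baseChange ℚ_[p]).formalFiltration 2 ≃+ ℤ_[p],
      ∀ (ι : K →+* ℚ_[p]) (P : (W.baseChange K).toAffine.Point),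
        ¬ IsOfFinAddOrder (padicPointOf W p ι P) →
        ((psi ((W.baseChange ℚ_[p]).formalFiltration 2) φ (padicPointOf W p ι P)).valuation : ℤ) =
          padicLogOrd W p ι P +
            padicValNat p ((W.baseChange ℚ_[p]).localTamagawaNumber ℤ_[p]) - 1 := by
  obtain ⟨φ, hφ⟩ := exists_addEquiv_valuation_psi_padicPointOf W p (K := K)
  refine ⟨φ, fun ι P hP ↦ ?_⟩
  rw [hφ ι P hP,
    padicValNat.eq_zero_of_not_dvd (LocalTorsion.not_dvd_reductionPointCount_of_mult W p hmult)]
  push_cast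
  ring

end Global

end Summit.BirchSwinnertonDyer.Rank1Residual.X11b.LocalIndex

end
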